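import Summits.Ventures.LatticeQCDFlow.Scoring.WilsonFlowRK3Reflection
import HarnessLib

/-!
# The RK3 integrator of the Wilson flow: continuity in the field and the step size, first-order consistency with Lüscher's flow equation, and the symmetric law of the measured charge

HONEST FRAMING: exact (Metropolis-corrected) sampling algorithms for lattice gauge theory;
figures of merit are autocorrelation/cost numbers at stated couplings and volumes; no
continuum-physics claim.

Venture `LatticeQCDFlow` (cell pub-lqcd), sub-topic `Scoring`; FANOUT row 16 (`su2-base`).  Third file on
Lüscher's integrator `wilsonFlowRK3 ε` = the engine's `lc_flow_rk3_step` (`Scoring/WilsonFlowRK3`: stages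
`rkRegister` / `rkPush`, `expSU`, `flowGen`, `wilsonFlowRK3_zero`; `Scoring/WilsonFlowRK3Reflection`:
`Θ'`-covariance and the odd measured charge), over the Literature Wilson flow (`QuantumFieldTheory/WilsonFlow`:
`wilsonFlowVF`, the ODE `hasDerivAt_wilsonFlow`, the smoothness lemmas `WilsonFlow.contDiff_suProj` /
`contDiff_loopSumAmb`, the entrywise calculus `WilsonFlow.hasDerivAt_entry`) and the `⟨Q⟩ = 0` packet
(`CloverChargeLawSymmetric.wilsonMeasure_map_neg_invariant_of_negReflect_odd`).  NEW WORK of the cell;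
nothing cited as a fact; no number.  Printed counterpart, NAMED ONLY: Lüscher, JHEP 08 (2010) 071, App. C
(the scheme is stated there to be third-order accurate; only FIRST order is proved here).

## What is here

* §1 (every `d`, `n`, `L ≥ 1`) `continuous_expSU`, `continuous_flowGen`, `continuous_rkRegister`,
  `continuous_rkPush`, **`continuous_wilsonFlowRK3_comp`** (joint continuity in step size and field along any
  continuous family), `continuous_wilsonFlowRK3_uncurry`, `continuous_wilsonFlowRK3`, `measurable_wilsonFlowRK3`,
  `continuous_iterate_wilsonFlowRK3`, `continuous_wilsonFlowRK3_left` — the RK3-flowed field is a continuous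
  (Borel) function of the configuration, so flowed observables are random variables under `μ_{Λ,β}`.
* §2 `hasDerivAt_smul_of_continuousAt` (`ε ↦ ε·k(ε)` has derivative `k(0)` at `0` for `k` merely continuous),
  `hasDerivAt_exp_comp_of_eq_zero` (`d exp_0 = id`), the stage rules `hasDerivAt_rkRegister`
  (`aε·Z(W_ε) + b·X_ε ↦ a·Z(W_0) + b·X'`) and `hasDerivAt_rkPush` (`e^{X_ε} W_ε ↦ X'·W_0 + W'`), and
  **`hasDerivAt_wilsonFlowRK3_zero`**: `d/dε RK3_ε(V)(e)|_{ε=0} = Z(V)(e)·V(e) = wilsonFlowVF V e` (Frobenius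
  norm on the ambient matrix space; the stages contribute `¼ + (8/9 − 17/36) + (¾ − 8/9 + 17/36) = 1`);
  the instance-free entrywise form `hasDerivAt_wilsonFlowRK3_apply_zero` (the shape of `IsWilsonFlowLine`) and
  **`isLittleO_wilsonFlowRK3_sub_wilsonFlow`**: entrywise `RK3_ε(V) − wilsonFlow ε V = o(ε)` — the engine's
  step is a consistent one-step method for Lüscher's equation `V̇ = −P(Ω(V)) V`.
* §3 (`d = 4`, `SU(n)` fundamental, `L ≥ 1`, every `β`, `ε`, `m`) the two observables row 16 records on the
  RK3-flowed field — the clover charge `Q_{ε,m} = Σ_x P_x ∘ RK3_ε^m` and the clover energy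
  `E_x ∘ RK3_ε^m` (the Literature's `flowedCloverEnergy ρ 0 x`, i.e. `Σ_{μ<ν} Re tr(G_{μν}ᴴG_{μν})` of the
  flowed links; row 16's `t²E`) — are measurable (`measurable_rk3CloverCharge`, `measurable_rk3CloverEnergy`)
  and gauge invariant (`isGaugeInvariant_rk3CloverCharge`, `isGaugeInvariant_rk3CloverEnergy`); `E ≥ 0` at
  every flow time (`flowedCloverEnergy_nonneg`); and **`wilsonMeasure_map_rk3CloverCharge_neg_invariant`**:
  the law of `Q_{ε,m}` under `μ_{Λ,β}` is invariant under `q ↦ −q`.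

NOT here: the order-three local error / global convergence `RK3_{t/m}^m → wilsonFlow t` (needs Lipschitz
control of `Z` along the scheme — the Literature has it for the exact flow only); step-size adaptivity;
anything about `τ_int`; any number.
-/

noncomputable section

open Matrix MeasureTheory Filter Topology Literature.MathematicalPhysics.QuantumFieldTheory
open Literature.MathematicalPhysics.QuantumLattice (fundamentalRep continuous_fundamentalRep
  fundamentalRep_mem_unitaryGroup cloverPseudoscalar continuous_cloverPseudoscalar)

namespace Summit.Ventures.LatticeQCDFlow.Scoring

variable {d L n : ℕ}

/-! ## §1 Continuity and measurability -/

section Continuity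

open scoped Matrix.Norms.Frobenius

/-- `expSU : 𝔰𝔲(n) → SU(n)` is continuous. -/
theorem continuous_expSU : Continuous (expSU (n := n)) :=
  (NormedSpace.exp_continuous.comp continuous_subtype_val).subtype_mk _

variable [NeZero L]

/-- The generator `V ↦ Z(V)(e)` is a continuous function of the configuration. -/
theorem continuous_flowGen (e : Edge d L) :
    Continuous fun V : GaugeConfig d L (Matrix.specialUnitaryGroup (Fin n) ℂ) => flowGen V e := by
  refine Continuous.subtype_mk ?_ _
  have h : Continuous fun V : GaugeConfig d L (Matrix.specialUnitaryGroup (Fin n) ℂ) =>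
      -suProj (WilsonFlow.loopSumAmb (WilsonFlow.coeConfig V) e.1 e.2) :=
    ((WilsonFlow.contDiff_suProj (m := 0)).continuous.comp
      ((WilsonFlow.contDiff_loopSumAmb (m := 0) e.1 e.2).continuous.comp WilsonFlow.continuous_coeConfig)).neg
  simpa only [WilsonFlow.loopSumAmb_coeConfig] using h

/-- A register update is jointly continuous in (step size, previous register, field). -/
theorem continuous_rkRegister {T : Type*} [TopologicalSpace T] (a b : ℝ) {εf : T → ℝ}
    {Xf : T → Edge d L → suAlgebra n} {Wf : T → GaugeConfig d L (Matrix.specialUnitaryGroup (Fin n) ℂ)}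
    (hε : Continuous εf) (hX : Continuous Xf) (hW : Continuous Wf) :
    Continuous fun t => rkRegister a b (εf t) (Xf t) (Wf t) := by
  refine continuous_pi fun e => ?_
  simp only [rkRegister]
  exact ((continuous_const.mul hε).smul ((continuous_flowGen e).comp hW)).add
    (((continuous_apply e).comp hX).const_smul b)

omit [NeZero L] in
/-- An exponential push is jointly continuous in (register, field). -/
theorem continuous_rkPush {T : Type*} [TopologicalSpace T]
    {Xf : T → Edge d L → suAlgebra n} {Wf : T → GaugeConfig d L (Matrix.specialUnitaryGroup (Fin n) ℂ)}
    (hX : Continuous Xf) (hW : Continuous Wf) : Continuous fun t => rkPush (Xf t) (Wf t) := by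
  refine continuous_pi fun e => ?_
  simp only [rkPush]
  exact (continuous_expSU.comp ((continuous_apply e).comp hX)).mul ((continuous_apply e).comp hW)

/-- **The integrator is jointly continuous in the step size and the field**: along any continuous
family `t ↦ (ε(t), V(t))` the RK3-flowed field is continuous. -/
theorem continuous_wilsonFlowRK3_comp {T : Type*} [TopologicalSpace T] {εf : T → ℝ}
    {Vf : T → GaugeConfig d L (Matrix.specialUnitaryGroup (Fin n) ℂ)} (hε : Continuous εf) (hV : Continuous Vf) :
    Continuous fun t => wilsonFlowRK3 (εf t) (Vf t) := by
  have hX₁ := continuous_rkRegister (1 / 4) 0 hε (continuous_const (y := fun _ : Edge d L => (0 : suAlgebra n))) hV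
  have hW₁ := continuous_rkPush hX₁ hV
  have hX₂ := continuous_rkRegister (8 / 9) (-17 / 9) hε hX₁ hW₁
  have hW₂ := continuous_rkPush hX₂ hW₁
  have hX₃ := continuous_rkRegister (3 / 4) (-1) hε hX₂ hW₂
  have hW₃ := continuous_rkPush hX₃ hW₂
  simpa only [wilsonFlowRK3] using hW₃

/-- The integrator is jointly continuous on `ℝ × (configurations)`. -/
theorem continuous_wilsonFlowRK3_uncurry :
    Continuous fun p : ℝ × GaugeConfig d L (Matrix.specialUnitaryGroup (Fin n) ℂ) => wilsonFlowRK3 p.1 p.2 :=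
  continuous_wilsonFlowRK3_comp continuous_fst continuous_snd

/-- The integrator at fixed step size is a continuous map of the configuration space. -/
theorem continuous_wilsonFlowRK3 (ε : ℝ) :
    Continuous fun V : GaugeConfig d L (Matrix.specialUnitaryGroup (Fin n) ℂ) => wilsonFlowRK3 ε V :=
  continuous_wilsonFlowRK3_comp continuous_const continuous_id

/-- … hence Borel measurable (so RK3-flowed observables are random variables under `μ_{Λ,β}`). -/
theorem measurable_wilsonFlowRK3 (ε : ℝ) :
    Measurable fun V : GaugeConfig d L (Matrix.specialUnitaryGroup (Fin n) ℂ) => wilsonFlowRK3 ε V :=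
  (continuous_wilsonFlowRK3 ε).measurable

/-- Any number of steps is continuous. -/
theorem continuous_iterate_wilsonFlowRK3 (ε : ℝ) (m : ℕ) :
    Continuous ((wilsonFlowRK3 (d := d) (L := L) (n := n) ε)^[m]) :=
  (continuous_wilsonFlowRK3 ε).iterate m

/-- The RK3-flowed field of a fixed configuration is a continuous function of the step size. -/
theorem continuous_wilsonFlowRK3_left (V : GaugeConfig d L (Matrix.specialUnitaryGroup (Fin n) ℂ)) :
    Continuous fun ε : ℝ => wilsonFlowRK3 ε V :=
  continuous_wilsonFlowRK3_comp continuous_id continuous_const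

end Continuity

/-! ## §2 First-order consistency with Lüscher's flow equation -/

section Consistency

open scoped Matrix.Norms.Frobenius

-- The scoped Frobenius instances are definitionally the product structures, but only at default transparency
-- (as in Mathlib's `MatrixExponential`).
set_option backward.isDefEq.respectTransparency false

/-- `ε ↦ ε • k(ε)` has derivative `k(0)` at `ε = 0` as soon as `k` is continuous at `0` (no differentiability
of `k` needed: the difference quotient IS `k`). -/
theorem hasDerivAt_smul_of_continuousAt {E : Type*} [NormedAddCommGroup E] [NormedSpace ℝ E] {k : ℝ → E}
    (hk : ContinuousAt k 0) : HasDerivAt (fun ε => ε • k ε) (k 0) 0 := by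
  rw [hasDerivAt_iff_tendsto_slope_zero]
  have h : Tendsto k (𝓝[≠] 0) (𝓝 (k 0)) := hk.tendsto.mono_left nhdsWithin_le_nhds
  refine h.congr' ?_
  filter_upwards [self_mem_nhdsWithin] with t (ht : t ≠ 0)
  rw [zero_add, zero_smul, sub_zero, smul_smul, inv_mul_cancel₀ ht, one_smul]

/-- `ε ↦ (c ε) • k(ε)` has derivative `c • k(0)` at `0` for `k` continuous at `0`. -/
theorem hasDerivAt_mul_smul_of_continuousAt {E : Type*} [NormedAddCommGroup E] [NormedSpace ℝ E] {k : ℝ → E}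
    (c : ℝ) (hk : ContinuousAt k 0) : HasDerivAt (fun ε => (c * ε) • k ε) (c • k 0) 0 := by
  have h := hasDerivAt_smul_of_continuousAt (k := fun ε => c • k ε) (hk.const_smul c)
  exact h.congr_of_eventuallyEq (Filter.Eventually.of_forall fun ε =>
    (by rw [mul_comm, mul_smul] : (c * ε) • k ε = ε • (c • k ε)))

/-- Chain rule through the matrix exponential at the origin: if `g(0) = 0` and `g'(0) = G` then
`(e^{g})' (0) = G` (`d exp_0 = id`, `hasFDerivAt_exp_zero`). -/
theorem hasDerivAt_exp_comp_of_eq_zero {g : ℝ → Matrix (Fin n) (Fin n) ℂ} {G : Matrix (Fin n) (Fin n) ℂ}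
    (hg : HasDerivAt g G 0) (h0 : g 0 = 0) : HasDerivAt (fun ε => NormedSpace.exp (g ε)) G 0 := by
  have he : HasFDerivAt NormedSpace.exp (1 : Matrix (Fin n) (Fin n) ℂ →L[ℝ] Matrix (Fin n) (Fin n) ℂ) (g 0) := by
    rw [h0]
    exact hasFDerivAt_exp_zero
  exact (he.comp_hasDerivAt (0 : ℝ) hg).congr_deriv rfl

variable [NeZero L]

/-- **Derivative of a register at `ε = 0`**: along curves `ε ↦ X_ε` (registers, `X_0(e) = ·` with derivative
`X'`) and `ε ↦ W_ε` (fields, continuous at `0`), the updated register `aε·Z(W_ε)(e) + b·X_ε(e)` has derivative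
`a·Z(W_0)(e) + b·X'` at `0`. -/
theorem hasDerivAt_rkRegister (a b : ℝ) {Xf : ℝ → Edge d L → suAlgebra n}
    {Wf : ℝ → GaugeConfig d L (Matrix.specialUnitaryGroup (Fin n) ℂ)} (e : Edge d L) {X' : Matrix (Fin n) (Fin n) ℂ}
    (hX : HasDerivAt (fun ε => ((Xf ε e : suAlgebra n) : Matrix (Fin n) (Fin n) ℂ)) X' 0) (hW : ContinuousAt Wf 0) :
    HasDerivAt (fun ε => ((rkRegister a b ε (Xf ε) (Wf ε) e : suAlgebra n) : Matrix (Fin n) (Fin n) ℂ))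
      (a • ((flowGen (Wf 0) e : suAlgebra n) : Matrix (Fin n) (Fin n) ℂ) + b • X') 0 := by
  have hk : ContinuousAt (fun ε => ((flowGen (Wf ε) e : suAlgebra n) : Matrix (Fin n) (Fin n) ℂ)) 0 :=
    ((continuous_subtype_val.comp (continuous_flowGen e)).continuousAt).comp hW
  have h := (hasDerivAt_mul_smul_of_continuousAt a hk).add (hX.const_smul b)
  simpa only [rkRegister, Submodule.coe_add, Submodule.coe_smul, Pi.add_def, Pi.smul_def] using h

omit [NeZero L] in
/-- **Derivative of a push at `ε = 0`**: if the register curve vanishes at `0` with derivative `X'` and the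
field curve has `W_0(e) = U` with derivative `W'`, then `ε ↦ e^{X_ε(e)} W_ε(e)` has derivative `X'·U + W'`. -/
theorem hasDerivAt_rkPush {Xf : ℝ → Edge d L → suAlgebra n}
    {Wf : ℝ → GaugeConfig d L (Matrix.specialUnitaryGroup (Fin n) ℂ)} (e : Edge d L)
    {X' W' : Matrix (Fin n) (Fin n) ℂ}
    (hX : HasDerivAt (fun ε => ((Xf ε e : suAlgebra n) : Matrix (Fin n) (Fin n) ℂ)) X' 0) (hX0 : Xf 0 e = 0)
    (hW : HasDerivAt (fun ε => ((Wf ε e : Matrix.specialUnitaryGroup (Fin n) ℂ) : Matrix (Fin n) (Fin n) ℂ)) W' 0) :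
    HasDerivAt (fun ε => ((rkPush (Xf ε) (Wf ε) e : Matrix.specialUnitaryGroup (Fin n) ℂ) : Matrix (Fin n) (Fin n) ℂ))
      (X' * ((Wf 0 e : Matrix.specialUnitaryGroup (Fin n) ℂ) : Matrix (Fin n) (Fin n) ℂ) + W') 0 := by
  have hexp := hasDerivAt_exp_comp_of_eq_zero hX (by rw [hX0, Submodule.coe_zero])
  have h := hexp.mul hW
  rw [hX0, Submodule.coe_zero, NormedSpace.exp_zero, Matrix.one_mul] at h
  simpa only [rkPush, WilsonFlow.coe_mul_SU, coe_expSU, Pi.mul_def] using h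

/-- **First-order consistency of the engine's integrator with Lüscher's flow equation.**  For every
configuration `V` and link `e`, the curve `ε ↦ RK3_ε(V)(e)` (in the ambient matrix space, Frobenius norm)
has derivative `Z(V)(e)·V(e) = wilsonFlowVF V e` at `ε = 0` — the right-hand side of `V̇ = −P(Ω(V)) V`
(`IsWilsonFlowLine`); the three stages contribute the weights `¼`, `8/9 − 17/36`, `¾ − 8/9 + 17/36`, which
sum to `1`. -/
theorem hasDerivAt_wilsonFlowRK3_zero (V : GaugeConfig d L (Matrix.specialUnitaryGroup (Fin n) ℂ)) (e : Edge d L) :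
    HasDerivAt (fun ε => ((wilsonFlowRK3 ε V e : Matrix.specialUnitaryGroup (Fin n) ℂ) : Matrix (Fin n) (Fin n) ℂ))
      (wilsonFlowVF V e) 0 := by
  set Xf₁ : ℝ → Edge d L → suAlgebra n := fun ε => rkRegister (1 / 4) 0 ε (fun _ => 0) V with hXf₁
  set Wf₁ : ℝ → GaugeConfig d L (Matrix.specialUnitaryGroup (Fin n) ℂ) := fun ε => rkPush (Xf₁ ε) V with hWf₁
  set Xf₂ : ℝ → Edge d L → suAlgebra n := fun ε => rkRegister (8 / 9) (-17 / 9) ε (Xf₁ ε) (Wf₁ ε) with hXf₂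
  set Wf₂ : ℝ → GaugeConfig d L (Matrix.specialUnitaryGroup (Fin n) ℂ) := fun ε => rkPush (Xf₂ ε) (Wf₁ ε) with hWf₂
  set Xf₃ : ℝ → Edge d L → suAlgebra n := fun ε => rkRegister (3 / 4) (-1) ε (Xf₂ ε) (Wf₂ ε) with hXf₃
  -- continuity of the stage curves in `ε`, and their values at `ε = 0`
  have hcX₁ : Continuous Xf₁ := continuous_rkRegister (1 / 4) 0 continuous_id continuous_const continuous_const
  have hcW₁ : Continuous Wf₁ := continuous_rkPush hcX₁ continuous_const
  have hcX₂ : Continuous Xf₂ := continuous_rkRegister (8 / 9) (-17 / 9) continuous_id hcX₁ hcW₁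
  have hcW₂ : Continuous Wf₂ := continuous_rkPush hcX₂ hcW₁
  have hX₁0 : Xf₁ 0 = fun _ => 0 := rkRegister_zero_step _ _ _
  have hW₁0 : Wf₁ 0 = V := by simp only [hWf₁, hX₁0, rkPush_zero]
  have hX₂0 : Xf₂ 0 = fun _ => 0 := by simp only [hXf₂, hX₁0, hW₁0, rkRegister_zero_step]
  have hW₂0 : Wf₂ 0 = V := by simp only [hWf₂, hX₂0, hW₁0, rkPush_zero]
  have hX₃0 : Xf₃ 0 = fun _ => 0 := by simp only [hXf₃, hX₂0, hW₂0, rkRegister_zero_step]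
  -- notation for the generator at `V` and the link
  set Z₀ : Matrix (Fin n) (Fin n) ℂ := ((flowGen V e : suAlgebra n) : Matrix (Fin n) (Fin n) ℂ) with hZ₀
  set U₀ : Matrix (Fin n) (Fin n) ℂ := ((V e : Matrix.specialUnitaryGroup (Fin n) ℂ) : Matrix (Fin n) (Fin n) ℂ)
    with hU₀
  -- stage 1
  have dX₁ : HasDerivAt (fun ε => ((Xf₁ ε e : suAlgebra n) : Matrix (Fin n) (Fin n) ℂ))
      ((1 / 4 : ℝ) • Z₀ + (0 : ℝ) • (0 : Matrix (Fin n) (Fin n) ℂ)) 0 := by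
    have h := hasDerivAt_rkRegister (1 / 4) 0 (Xf := fun _ _ => (0 : suAlgebra n)) (Wf := fun _ => V) e
      (X' := 0) (by simpa using hasDerivAt_const (0 : ℝ) (0 : Matrix (Fin n) (Fin n) ℂ)) continuousAt_const
    simpa only [hXf₁] using h
  have dW₁ : HasDerivAt (fun ε => ((Wf₁ ε e : Matrix.specialUnitaryGroup (Fin n) ℂ) : Matrix (Fin n) (Fin n) ℂ))
      (((1 / 4 : ℝ) • Z₀ + (0 : ℝ) • (0 : Matrix (Fin n) (Fin n) ℂ)) * U₀ + 0) 0 := by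
    have h := hasDerivAt_rkPush (Wf := fun _ => V) e dX₁ (by rw [hX₁0]) (hasDerivAt_const (0 : ℝ) U₀)
    simpa only [hWf₁] using h
  -- stage 2
  have dX₂ : HasDerivAt (fun ε => ((Xf₂ ε e : suAlgebra n) : Matrix (Fin n) (Fin n) ℂ))
      ((8 / 9 : ℝ) • Z₀ + (-17 / 9 : ℝ) • ((1 / 4 : ℝ) • Z₀ + (0 : ℝ) • (0 : Matrix (Fin n) (Fin n) ℂ))) 0 := by
    have h := hasDerivAt_rkRegister (8 / 9) (-17 / 9) e dX₁ hcW₁.continuousAt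
    rw [hW₁0] at h
    simpa only [hXf₂] using h
  have dW₂ : HasDerivAt (fun ε => ((Wf₂ ε e : Matrix.specialUnitaryGroup (Fin n) ℂ) : Matrix (Fin n) (Fin n) ℂ))
      (((8 / 9 : ℝ) • Z₀ + (-17 / 9 : ℝ) • ((1 / 4 : ℝ) • Z₀ + (0 : ℝ) • (0 : Matrix (Fin n) (Fin n) ℂ))) * U₀ +
        (((1 / 4 : ℝ) • Z₀ + (0 : ℝ) • (0 : Matrix (Fin n) (Fin n) ℂ)) * U₀ + 0)) 0 := by
    have h := hasDerivAt_rkPush e dX₂ (by rw [hX₂0]) dW₁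
    rw [hW₁0] at h
    simpa only [hWf₂] using h
  -- stage 3
  have dX₃ : HasDerivAt (fun ε => ((Xf₃ ε e : suAlgebra n) : Matrix (Fin n) (Fin n) ℂ))
      ((3 / 4 : ℝ) • Z₀ + (-1 : ℝ) •
        ((8 / 9 : ℝ) • Z₀ + (-17 / 9 : ℝ) • ((1 / 4 : ℝ) • Z₀ + (0 : ℝ) • (0 : Matrix (Fin n) (Fin n) ℂ)))) 0 := by
    have h := hasDerivAt_rkRegister (3 / 4) (-1) e dX₂ hcW₂.continuousAt
    rw [hW₂0] at h
    simpa only [hXf₃] using h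
  have dW₃ := hasDerivAt_rkPush e dX₃ (by rw [hX₃0]) dW₂
  rw [hW₂0] at dW₃
  -- assemble
  have hfun : (fun ε => ((wilsonFlowRK3 ε V e : Matrix.specialUnitaryGroup (Fin n) ℂ) : Matrix (Fin n) (Fin n) ℂ)) =
      fun ε => ((rkPush (Xf₃ ε) (Wf₂ ε) e : Matrix.specialUnitaryGroup (Fin n) ℂ) : Matrix (Fin n) (Fin n) ℂ) := by
    funext ε
    rfl
  rw [hfun]
  refine dW₃.congr_deriv ?_
  rw [wilsonFlowVF_eq_flowGen_mul, ← hZ₀, ← hU₀]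
  simp only [smul_zero, add_zero, smul_add, smul_smul, add_mul, smul_mul_assoc]
  module

/-- The same, entrywise and instance-free (the form of `IsWilsonFlowLine`): every matrix entry of
`ε ↦ RK3_ε(V)(e)` has derivative `(wilsonFlowVF V e)ᵢⱼ` at `ε = 0`. -/
theorem hasDerivAt_wilsonFlowRK3_apply_zero (V : GaugeConfig d L (Matrix.specialUnitaryGroup (Fin n) ℂ))
    (e : Edge d L) (i j : Fin n) :
    HasDerivAt (fun ε => ((wilsonFlowRK3 ε V e : Matrix.specialUnitaryGroup (Fin n) ℂ) : Matrix (Fin n) (Fin n) ℂ) i j)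
      (wilsonFlowVF V e i j) 0 :=
  WilsonFlow.hasDerivAt_entry (hasDerivAt_wilsonFlowRK3_zero V e) i j

/-- **The one-step error against the exact flow is `o(ε)`**: entrywise,
`RK3_ε(V)(e) − (wilsonFlow ε V)(e) = o(ε)` as `ε → 0` (both curves pass through `V(e)` with the same
velocity `wilsonFlowVF V e`; `hasDerivAt_wilsonFlow`).  The printed third order is NOT claimed. -/
theorem isLittleO_wilsonFlowRK3_sub_wilsonFlow (V : GaugeConfig d L (Matrix.specialUnitaryGroup (Fin n) ℂ))
    (e : Edge d L) (i j : Fin n) :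
    (fun ε : ℝ => ((wilsonFlowRK3 ε V e : Matrix.specialUnitaryGroup (Fin n) ℂ) : Matrix (Fin n) (Fin n) ℂ) i j -
        ((wilsonFlow ε V e : Matrix.specialUnitaryGroup (Fin n) ℂ) : Matrix (Fin n) (Fin n) ℂ) i j) =o[𝓝 0]
      fun ε => ε := by
  have h1 := hasDerivAt_wilsonFlowRK3_apply_zero V e i j
  have h2 := hasDerivAt_wilsonFlow V 0 e i j
  rw [wilsonFlow_zero] at h2
  have h := (h1.sub h2).isLittleO
  simp only [Pi.sub_apply, sub_self, sub_zero, wilsonFlowRK3_zero, wilsonFlow_zero, smul_zero] at h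
  exact h

end Consistency

/-! ## §3 The measured flowed clover charge is a random variable with a symmetric law -/

section Law

variable {L n : ℕ} [NeZero L]

/-- The measured flowed charge `U ↦ Σ_x P_x(RK3_ε^m U)` is continuous, hence measurable. -/
theorem measurable_rk3CloverCharge (ε : ℝ) (m : ℕ) :
    Measurable fun U : GaugeConfig 4 L (Matrix.specialUnitaryGroup (Fin n) ℂ) =>
      ∑ x : Site 4 L, cloverPseudoscalar (fundamentalRep (Fin n)) x ((wilsonFlowRK3 ε)^[m] U) := by
  refine Continuous.measurable (continuous_finsetSum _ fun x _ => ?_)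
  exact (continuous_cloverPseudoscalar (fundamentalRep (Fin n)) (continuous_fundamentalRep (Fin n)) x).comp
    (continuous_iterate_wilsonFlowRK3 ε m)

/-- **The law of the measured flowed clover charge is symmetric about `0`**: the push-forward of `μ_{Λ,β}`
under `Q_{ε,m}` is invariant under `q ↦ −q` — every `β`, `ε`, `m`, `L ≥ 1`, `n`. -/
theorem wilsonMeasure_map_rk3CloverCharge_neg_invariant (n : ℕ) (β ε : ℝ) (m : ℕ) :
    ((wilsonMeasure (fundamentalRep (Fin n)) β).map
        (fun U : GaugeConfig 4 L (Matrix.specialUnitaryGroup (Fin n) ℂ) =>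
          ∑ x : Site 4 L, cloverPseudoscalar (fundamentalRep (Fin n)) x ((wilsonFlowRK3 ε)^[m] U))).map Neg.neg =
      (wilsonMeasure (fundamentalRep (Fin n)) β).map
        (fun U : GaugeConfig 4 L (Matrix.specialUnitaryGroup (Fin n) ℂ) =>
          ∑ x : Site 4 L, cloverPseudoscalar (fundamentalRep (Fin n)) x ((wilsonFlowRK3 ε)^[m] U)) :=
  wilsonMeasure_map_neg_invariant_of_negReflect_odd (fundamentalRep (Fin n)) (continuous_fundamentalRep (Fin n)) β
    (measurable_rk3CloverCharge ε m) fun U => sum_cloverPseudoscalar_iterate_wilsonFlowRK3_negReflect ε m U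

/-! ### The second measured observable: the clover energy `E` of the RK3-flowed field (row 16's `t²E`) -/

omit [NeZero L] in
/-- **The clover action density is non-negative**: `E_x(U) = Σ_{μ<ν} Re tr(G_{μν}ᴴ G_{μν}) ≥ 0`, at every
flow time of the Literature's `flowedCloverEnergy` and for every representation — in particular for the
engine's `E` of an RK3-flowed field (so `t²⟨E⟩ ≥ 0` and the scale-setting equation is monotone data, not
a sign test). -/
theorem flowedCloverEnergy_nonneg {d N : ℕ} {R G : Type*} [AddGroup R] [One R] [Group G]
    (ρ : G →* Matrix (Fin N) (Fin N) ℂ) (t : ℝ) (x : Fin d → R) (U : (Fin d → R) × Fin d → G) :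
    0 ≤ Literature.MathematicalPhysics.QuantumLattice.flowedCloverEnergy ρ t x U := by
  unfold Literature.MathematicalPhysics.QuantumLattice.flowedCloverEnergy
  refine Finset.sum_nonneg fun μ _ => Finset.sum_nonneg fun ν _ => ?_
  split_ifs
  · exact WilsonFlow.re_trace_conjTranspose_mul_self_nonneg _
  · exact le_rfl

omit [NeZero L] in
/-- **The measured flowed energy is a gauge-invariant observable of the field**: for every site `x`,
step size `ε` and step count `m`, `U ↦ E_x(RK3_ε^m U)` (bare clover energy of the RK3-flowed `SU(n)`
field, fundamental representation) is invariant under `U ↦ U^g`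
(`isGaugeInvariant_comp_iterate_wilsonFlowRK3` + the Literature's `flowedCloverEnergy_zero_gaugeTransform`). -/
theorem isGaugeInvariant_rk3CloverEnergy (ε : ℝ) (m : ℕ) (x : Site 4 L) :
    IsGaugeInvariant fun U : GaugeConfig 4 L (Matrix.specialUnitaryGroup (Fin n) ℂ) =>
      Literature.MathematicalPhysics.QuantumLattice.flowedCloverEnergy (fundamentalRep (Fin n)) 0 x
        ((wilsonFlowRK3 ε)^[m] U) :=
  isGaugeInvariant_comp_iterate_wilsonFlowRK3
    (F := fun U : GaugeConfig 4 L (Matrix.specialUnitaryGroup (Fin n) ℂ) =>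
      Literature.MathematicalPhysics.QuantumLattice.flowedCloverEnergy (fundamentalRep (Fin n)) 0 x U)
    (fun g U => Literature.MathematicalPhysics.QuantumLattice.flowedCloverEnergy_zero_gaugeTransform
      (fundamentalRep (Fin n)) fundamentalRep_mem_unitaryGroup g U x) ε m

/-- Likewise the measured flowed clover charge `U ↦ Σ_x P_x(RK3_ε^m U)` is gauge invariant. -/
theorem isGaugeInvariant_rk3CloverCharge (ε : ℝ) (m : ℕ) :
    IsGaugeInvariant fun U : GaugeConfig 4 L (Matrix.specialUnitaryGroup (Fin n) ℂ) =>
      ∑ x : Site 4 L, cloverPseudoscalar (fundamentalRep (Fin n)) x ((wilsonFlowRK3 ε)^[m] U) :=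
  isGaugeInvariant_comp_iterate_wilsonFlowRK3
    (F := fun U : GaugeConfig 4 L (Matrix.specialUnitaryGroup (Fin n) ℂ) =>
      ∑ x : Site 4 L, cloverPseudoscalar (fundamentalRep (Fin n)) x U)
    (fun g U => Finset.sum_congr rfl fun x _ =>
      Literature.MathematicalPhysics.QuantumLattice.cloverPseudoscalar_gaugeTransform (fundamentalRep (Fin n))
        fundamentalRep_mem_unitaryGroup g U x) ε m

/-- The measured flowed energy at a site is a continuous, hence measurable, observable. -/
theorem measurable_rk3CloverEnergy (ε : ℝ) (m : ℕ) (x : Site 4 L) :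
    Measurable fun U : GaugeConfig 4 L (Matrix.specialUnitaryGroup (Fin n) ℂ) =>
      Literature.MathematicalPhysics.QuantumLattice.flowedCloverEnergy (fundamentalRep (Fin n)) 0 x
        ((wilsonFlowRK3 ε)^[m] U) :=
  ((Literature.MathematicalPhysics.QuantumLattice.continuous_flowedCloverEnergy_zero (fundamentalRep (Fin n))
    (continuous_fundamentalRep (Fin n)) x).comp (continuous_iterate_wilsonFlowRK3 ε m)).measurable

end Law



end Summit.Ventures.LatticeQCDFlow.Scoring

end
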